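import Summits.QuantumAdvantage.QuantumAdvantage.Theorems.CubicForrelationNearExactIsExactTenBalancedA

/-!
# Crux `CubicForrelation.NearExactIsExact` (stmt-QuantumAdvantage-14043), line `direct-sum-amplification`, lead c6:
  stub `stub_heavyEnergyBound` — budget arithmetic of the `n = 10` window

In the window `7/8 < Φ(f,g) < 1` at `n = 10` the Walsh values of the cubic `g` split along a hyperplane: on the
heavy half (`2⁹ = 512` points `x : Fin 9 → Bool`) `W_g = 32·p(x)` with `p(x)` odd, on the light half `W_g = 16·v(x)`
with `v(x)` odd, and the cost identity reads `Σ_heavy (32p − 32s)² + Σ_light (16v − 32s')² = 2²¹(1 − Φ) < 2¹⁸`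
(`s, s'` the signs of the partner `f`).  This file extracts the consequence the lead needs: `Σ_x p(x)² < 768`.

Proof.  (i) Each light term is `256·(odd − 2·(±1))² ≥ 256` (`tb_one_le_sq_odd_sub`, landed) and there are `512` of
them, so the light block costs `≥ 2¹⁷` and the heavy block `< 2¹⁷`, i.e. `Σ_x (p − s)² < 128`.  (ii) Pointwise, for an
odd integer `z = 2k+1` and a sign `σ = ±1`, `z² − 1 ≤ 2(z − σ)²` (it reads `k ≤ k²`, resp. `0 ≤ (k+1)(k+2)`, over `ℤ`).
(iii) Summing, `Σ p² ≤ 512 + 2·Σ (p − s)² < 512 + 256 = 768`.  Everything is elementary (Mathlib + the landed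
`tb_one_le_sq_odd_sub`); axioms are the standard three.
-/

set_option linter.dupNamespace false -- D-0017: single-problem summit ⇒ `QuantumAdvantage.QuantumAdvantage` by design

noncomputable section

namespace Summit.QuantumAdvantage.QuantumAdvantage.Theorems.CubicForrelation.NearExactIsExact

open Finset
open Literature.Computability.QuantumComplexity

/-- The two halves of the `n = 10` split have `2⁹ = 512` points each. [folklore] -/
theorem heb_card_nine : Fintype.card (Fin (4 + 4 + 1) → Bool) = 512 := by
  rw [Fintype.card_fun, Fintype.card_bool, Fintype.card_fin]
  rfl

/-- A constant summed over the `512`-point half. [folklore] -/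
theorem heb_sum_const (c : ℝ) : ∑ _x : Fin (4 + 4 + 1) → Bool, c = 512 * c := by
  rw [Finset.sum_const, Finset.card_univ, heb_card_nine, nsmul_eq_mul]
  norm_num

/-- For an odd integer `z` and a sign `σ = ±1`: `z² − 1 ≤ 2·(z − σ)²` (write `z = 2k+1`; for `σ = 1` this is
`k ≤ k²`, for `σ = −1` it is `0 ≤ (k+1)(k+2)`, both integer facts). [folklore] -/
theorem heb_sq_sub_one_le (z : ℤ) (hz : Odd z) (b : Bool) :
    (z : ℝ) ^ 2 - 1 ≤ 2 * ((z : ℝ) - signOf b) ^ 2 := by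
  obtain ⟨k, rfl⟩ := hz
  cases b
  · have hs : signOf false = 1 := rfl
    have h : ((2 * k + 1 : ℤ) : ℝ) - signOf false = ((2 * k : ℤ) : ℝ) := by
      rw [hs]; push_cast; ring
    rw [h]
    have h1 : ((2 * k + 1) ^ 2 - 1 : ℤ) ≤ 2 * (2 * k) ^ 2 := by
      have hk : k ≤ k ^ 2 := by
        rcases le_or_gt 1 k with hk | hk
        · nlinarith
        · nlinarith
      nlinarith
    exact_mod_cast h1
  · have hs : signOf true = -1 := rfl
    have h : ((2 * k + 1 : ℤ) : ℝ) - signOf true = ((2 * k + 2 : ℤ) : ℝ) := by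
      rw [hs]; push_cast; ring
    rw [h]
    have h1 : ((2 * k + 1) ^ 2 - 1 : ℤ) ≤ 2 * (2 * k + 2) ^ 2 := by
      have hk : 0 ≤ (k + 1) * (k + 2) := by
        rcases le_or_gt (-1) k with hk | hk
        · nlinarith
        · have : k + 2 ≤ 0 := by omega
          nlinarith
      nlinarith
    exact_mod_cast h1

/-- **Budget arithmetic of the `n = 10` window** (stub B′): if the heavy values `p` and the light values `v` are odd
and the total cost `Σ 1024·(p − s)² + Σ 256·(v − 2s')²` is `< 2¹⁸`, then the heavy energy `Σ p²` is `< 768`.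
[folklore] -/
theorem stub_heavyEnergyBound :
    ∀ (p v : (Fin (4 + 4 + 1) → Bool) → ℤ) (s s' : (Fin (4 + 4 + 1) → Bool) → Bool),
      (∀ x, Odd (p x)) → (∀ x, Odd (v x)) →
      (∑ x, (1024 : ℝ) * ((p x : ℝ) - signOf (s x)) ^ 2 + ∑ x, (256 : ℝ) * ((v x : ℝ) - 2 * signOf (s' x)) ^ 2 < 2 ^ 18) →
      ∑ x, ((p x : ℝ)) ^ 2 < 768 := by
  intro p v s s' hp hv hcost
  -- (i) the light block costs at least `512 · 256 = 2¹⁷`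
  have hlight : ∑ _x : Fin (4 + 4 + 1) → Bool, (256 : ℝ) ≤ ∑ x, (256 : ℝ) * ((v x : ℝ) - 2 * signOf (s' x)) ^ 2 :=
    Finset.sum_le_sum fun x _ => by
      have := tb_one_le_sq_odd_sub (v x) (hv x) (s' x)
      linarith
  -- (ii) the pointwise heavy bound, summed
  have hheavy : ∑ x, ((p x : ℝ)) ^ 2 ≤ ∑ x, ((1 : ℝ) + 2 * ((p x : ℝ) - signOf (s x)) ^ 2) :=
    Finset.sum_le_sum fun x _ => by
      have := heb_sq_sub_one_le (p x) (hp x) (s x)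
      linarith
  -- (iii) bookkeeping
  have h1024 : ∑ x, (1024 : ℝ) * ((p x : ℝ) - signOf (s x)) ^ 2 = 1024 * ∑ x, ((p x : ℝ) - signOf (s x)) ^ 2 :=
    (Finset.mul_sum _ _ _).symm
  rw [Finset.sum_add_distrib, heb_sum_const, ← Finset.mul_sum] at hheavy
  rw [heb_sum_const] at hlight
  rw [h1024] at hcost
  linarith

end Summit.QuantumAdvantage.QuantumAdvantage.Theorems.CubicForrelation.NearExactIsExact
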